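import Summits.QuantumFields.YangMills.Theorems.UnitScaleTiltProp7CornerCombLinesInhabited
import Summits.QuantumFields.YangMills.Theorems.UnitScaleTiltProp7CornerCombLambdaClosure
import HarnessLib

/-!
# Route `UnitScaleTilt`, crux K1 «MinimiserStabilityRegPr» (stmt-QuantumFields-19200), route-R E′ (A′)-on-Σ, P-A2 (β), row «(n3)-comb» —
# (O2) GROUNDWORK, file F-8b-3: THE SCALAR TOP KNIT — FROM THE INHABITED ROWS AND THE GAUGE ROW TO THE TWO-SLOT CELL BOUND

«(O2) groundwork — not consumed by any displayed row before the freeze lifts» (★★OWNER `ym3-torus-plan` g29∕g30 RULINGS №20 (2), №22 (c) «(II) GO»).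
Cell `ym3-torus`, width seat `ym-ust-19200-w5` (gen 8); pen F-8b «THE CELL THEOREM» (★routeR-w1 g9 PENS ROUND 5, 2026-08-29 10:02Z), file 3.  THEOREMS ONLY (0 `def`,
0 `sorry`); `--supports stmt-QuantumFields-19200 --as helper`, count-neutral.  YM₃ on T³ is a ladder rung (R3), not the Clay problem; nothing here claims `hMcomb`, (β),
`hPA2`, the stub, the crux, d = 4 or the mass gap.  Pure real analysis.

THE POINT.  The rows of the split comb tower in SCALAR letters — the sourceless mass and gradient lines `m_{j+1} ≤ (ρ + κ′_j)m_j`, `g_{j+1} ≤ ρ⁻¹g_j + K_j m_j` (✓F-8b-2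
`sqrt_mass_lin_step_le`∕`sqrt_grad_lin_step_le` at `d = 3`, `ρ = √(L²L⁻³)`, `ρ⁻¹ = √(L⁴L⁻³)`), the sourced mass line `n_{j+1} ≤ (ρ + κ′_j)n_j + σ_j·ỹ_j` (✓`sqrt_mass_sourced_step_le`),
the full-field letter `ỹ_j ≤ m_j + n_j + λ_j` (✓`sqrt_mass_full_le`), the windows GEOMETRIC FROM THE TOP (`κ′_j, K_j ≤ θ·ρ^{4(k−j)}`, `σ_j ≤ θ₂ρ^{2(k−j)}`, `wM_j ≤ ΘM·ρ^{4(k−j)}`) and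
the scalar gauge row of ✓F-7c-3 `lam_closure` — CLOSE: ★★★ `full_two_slot_of_rows` gives, for every `l ≤ k`,
`ỹ_l ≤ (e′m₀ + aN + aΛ)·ρ^l + (bN + bΛ)·(ρ⁻¹)^l` and `ỹ_l² ≤ 2(e′m₀ + aN + aΛ)²·(ρ^l)² + 2(bN + bΛ)²·((ρ⁻¹)^l)²`, `e′ = exp(θ′ρ³∕(1−ρ⁴))`, with the closed letters of ✓F-7c-3
`n_lam_two_slot` at `M := e′·m₀`, `Ĝ := g₀ + θ_g·e′·m₀·ρ^{2k}·ρ³∕(1−ρ²)` (top-anchored; `ρ^{2k} = (Lᵏ)⁻¹` on `T³`) (✓F-7c-1 `mass_line_le_geom`, `grad_line_le_geom_sharp`).  On `T³` (`(ρ^l)² = L^{−l}`, `((ρ⁻¹)^l)² = Lˡ`) this is the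
`A′·MASS₀·L^{−l} + (B′·GRAD₀ + windows·MASS₀)·Lˡ` shape of SPEC F-8 §2; the member file (F-8b-4: the DEF slot and ★routeR-w6's F-6d-3 read into `hrow`, the cell letters) plugs in.
HONEST SCOPE.  Bookkeeping; every window∕smallness∕constant inequality is a hypothesis (F-8c-3 discharges them from `RegPr`∕`In19`).  The top anchor `ρ^{2k}` in `Ĝ`
(`pow_top_feed_le_B_sharp`, the `hcB0sq` binder) is ★routeR-w1 g10's 2026-08-29 11:26Z seam repair (without it the B-letter carries `ε₀²·MASS₀` un-anchored and misses G3's `B′·ℓ⁻²` slot).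

References: T. Bałaban, CMP **109** (1987) 249–301 [Balaban1987RG1] ((0.1), (0.4) pp.251–253); CMP **98** (1985) 17–51 [Balaban1985Averaging] (Prop. 3 (122)–(126) p.36, Prop. 7);
CMP **95** (1984) 17–40 [Balaban1984PropagatorsI] ((1.18)–(1.20)).
-/

set_option autoImplicit false

noncomputable section

open scoped BigOperators
open Finset

namespace Summit.QuantumFields.YangMills.Theorems.Prop7CornerCombCellTheorem

open Summit.QuantumFields.YangMills.Theorems.Prop7CornerCombLevelInduction (mass_line_le_geom grad_line_le_geom_sharp)
open Summit.QuantumFields.YangMills.Theorems.Prop7CornerCombLambdaClosure (n_lam_closure n_lam_two_slot sq_le_two_slot)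

/-! ## §1 Two exponent facts -/

/-- `ρ^{4k+3−3l} ≤ ρ^{2k}·(ρ³·(ρ⁻¹)^l)` for `l ≤ k`, `0 < ρ < 1`: the sharp gradient feed read in B-shape KEEPING the top anchor `ρ^{2k}` (on `T³`, `ρ^{2k} = (Lᵏ)⁻¹`).
[folklore] -/
theorem pow_top_feed_le_B_sharp {ρ : ℝ} (hρ0 : 0 < ρ) (hρ1 : ρ < 1) {l k : ℕ} (hl : l ≤ k) :
    ρ ^ (4 * k + 3 - 3 * l) ≤ ρ ^ (2 * k) * (ρ ^ 3 * (ρ⁻¹) ^ l) := by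
  have hρl : 0 < ρ ^ l := pow_pos hρ0 l
  rw [inv_pow, ← mul_assoc, ← pow_add, ← div_eq_mul_inv, le_div_iff₀ hρl, ← pow_add]
  exact pow_le_pow_of_le_one hρ0.le hρ1.le (by omega)

/-- `exp(θ′ρ³∕(1−ρ⁴))·ρ^j·m₀ = (exp(…)·m₀)·ρ^j`. [folklore] -/
theorem mass_geom_reorder (e m₀ ρ : ℝ) (j : ℕ) : e * ρ ^ j * m₀ = (e * m₀) * ρ ^ j := by ring

/-! ## §2 ★★★ The scalar top knit -/

/-- ★★★ **THE SCALAR TOP KNIT OF THE SPLIT COMB TOWER.**  Reals `0 < ρ < 1`; nonnegative letters `θ′ θ_g θ₂ ΘM wG wN wS cA cB0 cB1`; nonnegative sequences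
`κ′ K σ m n g lam wM` (and `y`) on the levels `j ≤ k`.  ROWS (hypotheses): `m (j+1) ≤ (ρ + κ′ j)·m j`, `g (j+1) ≤ ρ⁻¹·g j + K j·m j`, `n (j+1) ≤ (ρ + κ′ j)·n j + σ j·y j`, `n 0 = 0`,
`y j ≤ m j + n j + lam j`, and the gauge row `lam j² ≤ Σ_{i<j}(ρ⁻¹)^{j−i}(wG·g i² + wN·n i² + wM i·(m i² + n i²) + wS·σ i²·(m i + n i + lam i)²)`; WINDOWS: `κ′ j, K j ≤ θ·ρ^{4(k−j)}`,
`σ j ≤ θ₂ρ^{2(k−j)}`, `wM j ≤ ΘM·ρ^{4(k−j)}`; SMALLNESS∕CONSTANTS as in ✓F-7c-3 `n_lam_closure` at `M := e′·m 0`, `Ĝ := g 0 + θ_g·e′·m 0·ρ^{2k}·ρ³∕(1−ρ²)`, `e′ = exp(θ′ρ³∕(1−ρ⁴))`.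
CONCLUSION: for every `l ≤ k`, with `aN = 2e′θ₂(M + cA)ρ∕(1−ρ²)`, `bN = 2e′θ₂cB0ρ³∕(1−ρ⁴)`:
`y l ≤ (M + aN + (cA + cB1·aN))·ρ^l + (bN + (cB0 + cB1·bN))·(ρ⁻¹)^l`.
PROOF: ✓`mass_line_le_geom` (`m`), ✓`grad_line_le_geom_sharp` (`g`, read in B-shape by `pow_top_feed_le_B_sharp`, keeping `ρ^{2k}`), ✓`n_lam_closure` + ✓`n_lam_two_slot` (`n`, `lam`), and `y ≤ m + n + lam`.
[Balaban1987RG1 (0.1)∕(0.4) pp.251–253, scalar form] -/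
theorem full_two_slot_of_rows {ρ θ' θg θ₂ ΘM wG wN wS cA cB0 cB1 : ℝ} (hρ0 : 0 < ρ) (hρ1 : ρ < 1) (hθ' : 0 ≤ θ') (hθg : 0 ≤ θg) (hθ₂ : 0 ≤ θ₂)
    (hΘM : 0 ≤ ΘM) (hwG : 0 ≤ wG) (hwN : 0 ≤ wN) (hwS : 0 ≤ wS) (hcA : 0 ≤ cA) (hcB0 : 0 ≤ cB0) (hcB1 : 0 ≤ cB1)
    (κ' K σ m n g y lam wM : ℕ → ℝ) (hκ' : ∀ j, 0 ≤ κ' j) (hK : ∀ j, 0 ≤ K j) (hσ : ∀ j, 0 ≤ σ j) (hm0 : ∀ j, 0 ≤ m j) (hn : ∀ j, 0 ≤ n j)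
    (hg0 : ∀ j, 0 ≤ g j) (hlam : ∀ j, 0 ≤ lam j) (hwM0 : ∀ j, 0 ≤ wM j) {k : ℕ}
    (hκ'geo : ∀ j < k, κ' j ≤ θ' * ρ ^ (4 * (k - j))) (hKgeo : ∀ j < k, K j ≤ θg * ρ ^ (4 * (k - j)))
    (hσgeo : ∀ j < k, σ j ≤ θ₂ * ρ ^ (2 * (k - j))) (hwMgeo : ∀ j < k, wM j ≤ ΘM * ρ ^ (4 * (k - j)))
    (hmrec : ∀ j < k, m (j + 1) ≤ (ρ + κ' j) * m j) (hgrec : ∀ j < k, g (j + 1) ≤ ρ⁻¹ * g j + K j * m j)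
    (hn0 : n 0 = 0) (hnrec : ∀ j < k, n (j + 1) ≤ (ρ + κ' j) * n j + σ j * y j) (hy : ∀ j ≤ k, y j ≤ m j + n j + lam j)
    (hrow : ∀ j ≤ k, lam j ^ 2 ≤ ∑ i ∈ Finset.range j,
      (ρ⁻¹) ^ (j - i) * (wG * g i ^ 2 + wN * n i ^ 2 + wM i * (m i ^ 2 + n i ^ 2) + wS * σ i ^ 2 * (m i + n i + lam i) ^ 2))
    (hsmall : Real.exp (θ' * (ρ ^ 3 / (1 - ρ ^ 4))) * θ₂ * (1 + cB1) * (ρ ^ 3 / (1 - ρ ^ 4)) ≤ 1 / 2)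
    (hsmallS : 12 * wS * θ₂ ^ 2 * (ρ / (1 - ρ)) ≤ 1 / 2)
    (hcB0sq : 2 * wG * (g 0 + θg * Real.exp (θ' * (ρ ^ 3 / (1 - ρ ^ 4))) * m 0 * ρ ^ (2 * k) * (ρ ^ 3 / (1 - ρ ^ 2))) ^ 2 * (ρ / (1 - ρ)) ≤ cB0 ^ 2)
    (hcB1sq : 2 * (wN * (ρ / (1 - ρ)) + (ΘM + 3 * wS * θ₂ ^ 2) * (ρ ^ 5 / (1 - ρ ^ 5))) ≤ cB1 ^ 2)
    (hcAsq : 2 * ((ΘM + 3 * wS * θ₂ ^ 2) * (Real.exp (θ' * (ρ ^ 3 / (1 - ρ ^ 4))) * m 0) ^ 2) * (ρ / (1 - ρ)) ≤ cA ^ 2) :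
    ∀ l ≤ k,
      y l ≤ (Real.exp (θ' * (ρ ^ 3 / (1 - ρ ^ 4))) * m 0
              + 2 * Real.exp (θ' * (ρ ^ 3 / (1 - ρ ^ 4))) * θ₂ * (Real.exp (θ' * (ρ ^ 3 / (1 - ρ ^ 4))) * m 0 + cA) * (ρ / (1 - ρ ^ 2))
              + (cA + cB1 * (2 * Real.exp (θ' * (ρ ^ 3 / (1 - ρ ^ 4))) * θ₂ * (Real.exp (θ' * (ρ ^ 3 / (1 - ρ ^ 4))) * m 0 + cA) * (ρ / (1 - ρ ^ 2)))))
            * ρ ^ l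
        + (2 * Real.exp (θ' * (ρ ^ 3 / (1 - ρ ^ 4))) * θ₂ * cB0 * (ρ ^ 3 / (1 - ρ ^ 4))
            + (cB0 + cB1 * (2 * Real.exp (θ' * (ρ ^ 3 / (1 - ρ ^ 4))) * θ₂ * cB0 * (ρ ^ 3 / (1 - ρ ^ 4))))) * (ρ⁻¹) ^ l := by
  set e' : ℝ := Real.exp (θ' * (ρ ^ 3 / (1 - ρ ^ 4))) with he'
  have he0 : 0 ≤ e' := (Real.exp_pos _).le
  have hρ2 : ρ ^ 2 < 1 := pow_lt_one₀ hρ0.le hρ1 (by norm_num)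
  have h12 : 0 < 1 - ρ ^ 2 := by linarith
  set M : ℝ := e' * m 0 with hM
  have hM0 : 0 ≤ M := mul_nonneg he0 (hm0 0)
  set Ĝ : ℝ := g 0 + θg * e' * m 0 * ρ ^ (2 * k) * (ρ ^ 3 / (1 - ρ ^ 2)) with hĜ
  -- the sourceless lines closed (✓F-7c-1)
  have hm : ∀ j ≤ k, m j ≤ M * ρ ^ j := fun j hj => by
    have := mass_line_le_geom hρ0 hρ1 hθ' κ' m hκ' hm0 hj (fun i hi => hκ'geo i (by omega)) (fun i hi => hmrec i (by omega))
    rw [mass_geom_reorder] at this; exact this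
  have hg : ∀ j ≤ k, g j ≤ Ĝ * (ρ⁻¹) ^ j := fun j hj => by
    have h := grad_line_le_geom_sharp hρ0 hρ1 hθg hθ' K κ' g m hK hκ' hg0 hm0 hKgeo hκ'geo hmrec hgrec hj
    have hfeed : θg * e' * m 0 * (ρ ^ (4 * k + 3 - 3 * j) / (1 - ρ ^ 2)) ≤ θg * e' * m 0 * ρ ^ (2 * k) * (ρ ^ 3 / (1 - ρ ^ 2)) * (ρ⁻¹) ^ j := by
      have hc : 0 ≤ θg * e' * m 0 / (1 - ρ ^ 2) := div_nonneg (mul_nonneg (mul_nonneg hθg he0) (hm0 0)) h12.le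
      have := mul_le_mul_of_nonneg_left (pow_top_feed_le_B_sharp hρ0 hρ1 hj) hc
      calc θg * e' * m 0 * (ρ ^ (4 * k + 3 - 3 * j) / (1 - ρ ^ 2)) = θg * e' * m 0 / (1 - ρ ^ 2) * ρ ^ (4 * k + 3 - 3 * j) := by ring
        _ ≤ θg * e' * m 0 / (1 - ρ ^ 2) * (ρ ^ (2 * k) * (ρ ^ 3 * (ρ⁻¹) ^ j)) := this
        _ = _ := by ring
    calc g j ≤ (ρ⁻¹) ^ j * g 0 + θg * e' * m 0 * (ρ ^ (4 * k + 3 - 3 * j) / (1 - ρ ^ 2)) := h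
      _ ≤ (ρ⁻¹) ^ j * g 0 + θg * e' * m 0 * ρ ^ (2 * k) * (ρ ^ 3 / (1 - ρ ^ 2)) * (ρ⁻¹) ^ j := by linarith
      _ = Ĝ * (ρ⁻¹) ^ j := by simp only [hĜ]; ring
  -- the sourced line reads the full field through `y ≤ m + n + lam`
  have hrec : ∀ j < k, n (j + 1) ≤ (ρ + κ' j) * n j + σ j * (m j + n j + lam j) := fun j hj =>
    (hnrec j hj).trans (by nlinarith [hσ j, hy j hj.le])
  have hcl := n_lam_closure hρ0 hρ1 hθ' hθ₂ hΘM hwG hwN hwS hM0 hcA hcB0 hcB1 κ' σ n m g lam wM hκ' hσ hn hm0 hg0 hlam hwM0 hκ'geo hσgeo hwMgeo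
    hm hg hn0 hrec hrow hsmall hsmallS (by simpa only [hĜ] using hcB0sq) hcB1sq (by simpa only [hM] using hcAsq)
  have hts := n_lam_two_slot hρ0 hρ1 hθ₂ hM0 hcA hcB1 n lam hcl
  intro l hl
  obtain ⟨hnl, hll⟩ := hts l hl
  have hml := hm l hl
  have hyl := hy l hl
  have e1 : (M + 2 * e' * θ₂ * (M + cA) * (ρ / (1 - ρ ^ 2)) + (cA + cB1 * (2 * e' * θ₂ * (M + cA) * (ρ / (1 - ρ ^ 2))))) * ρ ^ l
        + (2 * e' * θ₂ * cB0 * (ρ ^ 3 / (1 - ρ ^ 4)) + (cB0 + cB1 * (2 * e' * θ₂ * cB0 * (ρ ^ 3 / (1 - ρ ^ 4))))) * (ρ⁻¹) ^ l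
      = M * ρ ^ l + ((2 * e' * θ₂ * (M + cA) * (ρ / (1 - ρ ^ 2))) * ρ ^ l + (2 * e' * θ₂ * cB0 * (ρ ^ 3 / (1 - ρ ^ 4))) * (ρ⁻¹) ^ l)
        + ((cA + cB1 * (2 * e' * θ₂ * (M + cA) * (ρ / (1 - ρ ^ 2)))) * ρ ^ l + (cB0 + cB1 * (2 * e' * θ₂ * cB0 * (ρ ^ 3 / (1 - ρ ^ 4)))) * (ρ⁻¹) ^ l) := by
    ring
  rw [e1]
  linarith

/-- The squared form: `y l² ≤ 2·A²·(ρ^l)² + 2·B²·((ρ⁻¹)^l)²` for the two closed letters `A`, `B` of `full_two_slot_of_rows` (✓`sq_le_two_slot`); on `T³`, `(ρ^l)² = L^{−l}` and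
`((ρ⁻¹)^l)² = Lˡ`. [Balaban1987RG1 (0.4) p.253] -/
theorem sq_two_slot_of_le {y A B ρ : ℝ} {l : ℕ} (hy : 0 ≤ y) (h : y ≤ A * ρ ^ l + B * (ρ⁻¹) ^ l) :
    y ^ 2 ≤ 2 * (A ^ 2 * (ρ ^ l) ^ 2) + 2 * (B ^ 2 * ((ρ⁻¹) ^ l) ^ 2) :=
  sq_le_two_slot hy h

/-- The `T³` reading of the two slots: with `ρ = (√L)⁻¹` (`L > 0`), `(ρ^l)² = (Lˡ)⁻¹` and `((ρ⁻¹)^l)² = Lˡ`. [folklore] -/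
theorem rho_slots_T3 {L : ℝ} (hL : 0 < L) (l : ℕ) :
    (((Real.sqrt L)⁻¹) ^ l) ^ 2 = (L ^ l)⁻¹ ∧ ((((Real.sqrt L)⁻¹)⁻¹) ^ l) ^ 2 = L ^ l := by
  have hs : Real.sqrt L ^ 2 = L := Real.sq_sqrt hL.le
  refine ⟨?_, ?_⟩
  · rw [inv_pow, inv_pow, ← pow_mul, mul_comm, pow_mul, hs]
  · rw [inv_inv, ← pow_mul, mul_comm, pow_mul, hs]

/-- The `T³` letters of the two step contractions: `√(L²·(L³)⁻¹) = (√L)⁻¹` and `√(L⁴·(L³)⁻¹) = ((√L)⁻¹)⁻¹` (`L > 0`) — ★routeR-w4's F-7b-1∕F-7b-2 `ρ`, `ρ_g` at `d = 3`. [folklore] -/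
theorem rho_letters_T3 {L : ℝ} (hL : 0 < L) :
    Real.sqrt (L ^ 2 * (L ^ 3)⁻¹) = (Real.sqrt L)⁻¹ ∧ Real.sqrt (L ^ 4 * (L ^ 3)⁻¹) = ((Real.sqrt L)⁻¹)⁻¹ := by
  have hL0 : L ≠ 0 := hL.ne'
  have h1 : L ^ 2 * (L ^ 3)⁻¹ = L⁻¹ := by field_simp
  have h2 : L ^ 4 * (L ^ 3)⁻¹ = L := by field_simp
  rw [h1, h2, Real.sqrt_inv, inv_inv]
  exact ⟨rfl, rfl⟩

/-- `0 < (√L)⁻¹ < 1` for `L > 1`. [folklore] -/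
theorem rho_pos_lt_one_T3 {L : ℝ} (hL : 1 < L) : 0 < (Real.sqrt L)⁻¹ ∧ (Real.sqrt L)⁻¹ < 1 := by
  have hs : 1 < Real.sqrt L := by
    have := Real.sqrt_lt_sqrt (by norm_num) hL
    rwa [Real.sqrt_one] at this
  exact ⟨inv_pos.mpr (by linarith), inv_lt_one_of_one_lt₀ hs⟩

end Summit.QuantumFields.YangMills.Theorems.Prop7CornerCombCellTheorem

end
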